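import Summits.ValiantsHypothesis.ValiantsHypothesis.Theorems.VPBoundarySquareRootsPresentable
import HarnessLib

/-!
# Roots are presentable (unconditional form) and the edge `U_ε → U_root` (E1 / S3b)

Helper file for route `VPBoundarySquare` (series O-L3-12, last file). `L_ε` = BDS's
presentable measure (`ε` a circuit input, constants in `F`; tree `presBorderComplexity`).
`presBorderComplexity_aeval_le`: `L_ε(f(θ)) ≤ L_ε(f) + Σ_i L(θ_i)` for `θ_i` OVER `F` (twin of
the tree's `borderComplexity_aeval_le`). `presBorderComplexity_le_pow_of_isRoot` — **roots are
presentable**: `H ≠ 0`, `H(x, φ(x)) = 0`, characteristic zero ⟹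
`L_ε(φ) ≤ 32 (deg φ + L(H) + #β + 2)^6`, independently of `deg H` and the multiplicity (Bürgisser
2004 Thm 1.3 / BDS 2024 Lemma 4.4 in root form), reduced to S3's good-point theorem
`presBorderComplexity_le_of_factorization` as the tree reduces `exists_polyOrdGE_of_isRoot`
(factor `H = (y - φ)^e Q` by `Polynomial.rootMultiplicity`, translate `x ↦ x + a` to a good point
and back). `rootsDefinable_of_closureDefinablePres`: `U_ε → U_root` (item 23449
`ClosureDefinablePres` implies item 23450 `RootsDefinable`) via `isPresVPBarFamily_of_isRoot`.
[cite: Burgisser2004Factors, Thm. 1.3, Cor. 1.4; BhargavDwivediSaxena2024, Def. 4.3, Lemma 4.4]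
-/
noncomputable section

set_option linter.dupNamespace false

namespace Summit.ValiantsHypothesis.ValiantsHypothesis.Theorems.VPBoundarySquareRootsDefinable

open MvPolynomial Finset Literature.Computability.AlgebraicComplexity
open Literature.Computability.AlgebraicComplexity.ArithCircuit
open Summit.ValiantsHypothesis.ValiantsHypothesis.Theorems.VPBoundarySquareRootsPresentable

universe u v w

section Substitution

variable {F : Type u} [Field F] {σ : Type v} {τ : Type w} [Fintype σ]

/-- **`L_ε` under substitution over `F`**: `L_ε(f(θ)) ≤ L_ε(f) + Σ_i L(θ_i)` for
`θ_i ∈ F[x_τ]` — substitute `θ_i` (renamed into `F[x_τ, ε]`) for `x_i` in a presenting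
polynomial `G(x, ε)`; the order `M` is unchanged (twin, in BDS's presentable model, of the
tree's `borderComplexity_aeval_le`).
[cite: BhargavDwivediSaxena2024, Def. 4.3; Burgisser2004Factors, §3.2] -/
theorem presBorderComplexity_aeval_le (θ : σ → MvPolynomial τ F) (f : MvPolynomial σ F) :
    presBorderComplexity (aeval θ f) ≤ presBorderComplexity f + ∑ i, complexity (θ i) := by
  classical
  obtain ⟨M, G, hc, hP⟩ := exists_presents_complexity_le f
  refine (presBorderComplexity_le_iff _ _).2
    ⟨M, aeval (fun o : Option σ => o.elim (X none) fun i => rename some (θ i)) G, ?_, ?_⟩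
  · refine (complexity_aeval_le G _).trans (add_le_add hc ?_)
    rw [Fintype.sum_option]
    simp only [Option.elim_none, Option.elim_some]
    rw [complexity_X_holds none, zero_add]
    exact Finset.sum_le_sum fun i _ => complexity_rename_le_holds' some (θ i)
  · unfold Presents at hP ⊢
    set ι := algebraMap F (LaurentSeries F) with hι
    have hcomp : (aeval (epsSubst F τ)).comp
          (bind₁ fun o : Option σ => MvPolynomial.map ι
            ((fun o : Option σ => o.elim (X none) fun i => rename some (θ i)) o)) =
        (bind₁ fun i => MvPolynomial.map ι (θ i)).comp (aeval (epsSubst F σ)) := by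
      refine MvPolynomial.algHom_ext fun o => ?_
      rcases o with _ | i
      · simp [epsSubst]
      · have hθ : epsSubst F τ ∘ some = X := funext fun _ => rfl
        have hi : epsSubst F σ (some i) = X i := rfl
        simp only [AlgHom.comp_apply, bind₁_X_right, aeval_X, Option.elim_some, map_rename,
          aeval_rename, hθ, aeval_X_left_apply, hi]
    have h2 : aeval (epsSubst F τ) (MvPolynomial.map ι
          (aeval (fun o : Option σ => o.elim (X none) fun i => rename some (θ i)) G)) =
        bind₁ (fun i => MvPolynomial.map ι (θ i))
          (aeval (epsSubst F σ) (MvPolynomial.map ι G)) := by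
      have := AlgHom.congr_fun hcomp (MvPolynomial.map ι G)
      rw [AlgHom.comp_apply, AlgHom.comp_apply, ← map_bind₁] at this
      exact this
    rw [show MvPolynomial.map ι (aeval θ f) = _ from map_bind₁ ι θ f, h2,
      ← bind₁_C_right (fun i => MvPolynomial.map ι (θ i)), ← map_mul, ← map_sub]
    exact PolyOrdGE.bind₁ hP fun i => PolyOrdGE.map_algebraMap (θ i)

end Substitution

section Translate

variable {L : Type u} [Field L] {β : Type v}

/-- `x_b ↦ x_b + a_b` (`y` fixed) acts on `L[x][y]` coefficientwise. [folklore] -/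
private theorem oel_translate (a : β → L) (G : MvPolynomial (Option β) L) :
    optionEquivLeft L β
        (aeval (fun o : Option β => o.elim (X none) fun b => X (some b) + C (a b)) G) =
      Polynomial.map ((aeval fun b : β => X b + C (a b) : MvPolynomial β L →ₐ[L]
        MvPolynomial β L) : MvPolynomial β L →+* MvPolynomial β L)
        (optionEquivLeft L β G) := by
  have key : ((optionEquivLeft L β : MvPolynomial (Option β) L ≃ₐ[L]
      Polynomial (MvPolynomial β L)) : MvPolynomial (Option β) L →+*
        Polynomial (MvPolynomial β L)).comp
        (aeval (fun o : Option β => o.elim (X none) fun b => X (some b) + C (a b)) :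
          MvPolynomial (Option β) L →ₐ[L] MvPolynomial (Option β) L) =
      (Polynomial.mapRingHom ((aeval fun b : β => X b + C (a b) :
          MvPolynomial β L →ₐ[L] MvPolynomial β L) :
            MvPolynomial β L →+* MvPolynomial β L)).comp
        ((optionEquivLeft L β : MvPolynomial (Option β) L ≃ₐ[L]
            Polynomial (MvPolynomial β L)) :
          MvPolynomial (Option β) L →+* Polynomial (MvPolynomial β L)) := by
    refine MvPolynomial.ringHom_ext (fun r => ?_) (fun o => ?_)
    · simp [optionEquivLeft_C]
    · rcases o with _ | b
      · simp [optionEquivLeft_X_none]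
      · simp [optionEquivLeft_X_some]
  exact RingHom.congr_fun key G

/-- The constant term after `x ↦ x + a` is the value at `a`. [folklore] -/
private theorem constantCoeff_translate (a : β → L) (u : MvPolynomial β L) :
    constantCoeff (aeval (fun b : β => X b + C (a b)) u) = eval a u := by
  have key : (constantCoeff : MvPolynomial β L →+* L).comp
      (aeval (R := L) fun b : β => X b + C (a b)).toRingHom = eval a := by
    refine MvPolynomial.ringHom_ext (fun c => ?_) (fun b => ?_)
    · simp
    · simp
  exact RingHom.congr_fun key u

/-- `x ↦ x - a` after `x ↦ x + a` is the identity. [folklore] -/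
private theorem translate_back (a : β → L) (p : MvPolynomial β L) :
    aeval (fun b : β => X b + C (-a b)) (aeval (fun b : β => X b + C (a b)) p) = p := by
  have key : (aeval fun b : β => X b + C (-a b) :
      MvPolynomial β L →ₐ[L] MvPolynomial β L).comp (aeval fun b : β => X b + C (a b)) =
      AlgHom.id L _ := by
    refine MvPolynomial.algHom_ext fun b => ?_
    simp only [AlgHom.comp_apply, aeval_X, map_add, aeval_C, algebraMap_eq, AlgHom.id_apply,
      map_neg, add_assoc, neg_add_cancel, add_zero]
  exact AlgHom.congr_fun key p

/-- A substitution by polynomials of degree `≤ 1` does not raise the total degree. [folklore] -/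
private theorem totalDegree_aeval_linear {γ : Type w} {t : β → MvPolynomial γ L}
    (ht : ∀ b, (t b).totalDegree ≤ 1) (p : MvPolynomial β L) :
    (aeval t p).totalDegree ≤ p.totalDegree := by
  classical
  conv_lhs => rw [p.as_sum]
  rw [map_sum]
  refine totalDegree_finsetSum_le fun m hm => ?_
  rw [aeval_monomial, algebraMap_eq]
  refine (totalDegree_mul _ _).trans ?_
  rw [totalDegree_C, zero_add]
  simp only [Finsupp.prod]
  refine (totalDegree_finsetProd _ _).trans ?_
  calc ∑ i ∈ m.support, (t i ^ m i).totalDegree ≤ ∑ i ∈ m.support, m i := by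
        refine Finset.sum_le_sum fun i _ => (totalDegree_pow _ _).trans ?_
        calc m i * (t i).totalDegree ≤ m i * 1 := Nat.mul_le_mul_left _ (ht i)
          _ = m i := mul_one _
    _ ≤ p.totalDegree := by
        have := le_totalDegree hm
        simpa only [Finsupp.sum] using this

/-- `optionEquivLeft` turns the substitution `y ↦ z` into univariate evaluation. [folklore] -/
private theorem eval_oel_eq_aeval (H : MvPolynomial (Option β) L) (z : MvPolynomial β L) :
    Polynomial.eval z (optionEquivLeft L β H) = aeval (fun o : Option β => o.elim z X) H := by
  induction H using MvPolynomial.induction_on with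
  | C a => simp [optionEquivLeft_C]
  | add p q hp hq => simp only [map_add, Polynomial.eval_add, hp, hq]
  | mul_X p o hp =>
    rcases o with _ | b <;> simp [hp, optionEquivLeft_X_none, optionEquivLeft_X_some]

/-- `Σ_b L(x_{g b} + c_b) ≤ #β`: one addition gate each. [cite: Burgisser2000, §2.1] -/
private theorem sum_cx_X_add_C [Fintype β] {γ : Type w} (g : β → γ) (c : β → L) :
    ∑ b, complexity (X (g b) + C (c b) : MvPolynomial γ L) ≤ Fintype.card β :=
  calc ∑ b, complexity (X (g b) + C (c b) : MvPolynomial γ L) ≤ ∑ _b : β, 1 :=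
        Finset.sum_le_sum fun b _ => by
          have := complexity_add_le_holds (X (g b) : MvPolynomial γ L) (C (c b))
          rw [complexity_X_holds, complexity_C_holds] at this
          omega
    _ = Fintype.card β := by simp

end Translate

section Main

variable {F : Type u} [Field F] [CharZero F] {β : Type v} [Fintype β]

/-- **Roots are presentable, one-parameter form** (`A ≥ deg φ`, `A ≥ L(H) + #β`; S3's bound at
`d = A`, `μ = (A+1)²`, `Ξ = 4(4A+2)²+1`, plus `#β` gates back): reduction to
`presBorderComplexity_le_of_factorization` at a good point `a` (`Q(a, φ(a)) ≠ 0`, `F` infinite)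
via `x ↦ x ± a`. [cite: Burgisser2004Factors, Thm. 1.3; BhargavDwivediSaxena2024, Lemma 4.4] -/
private theorem presBorderComplexity_le_of_isRoot_aux (φ : MvPolynomial β F)
    {H : MvPolynomial (Option β) F} (hH : H ≠ 0)
    (hroot : bind₁ (fun o : Option β => o.elim φ X) H = 0) {A : ℕ} (hd : φ.totalDegree ≤ A)
    (hl : complexity H + Fintype.card β ≤ A) :
    presBorderComplexity φ ≤
      2 * (3 * ((A + 1) * (A * (A + 6) + 2 * A + 2)) + 2) ^ 2 +
        5 * (A + 4 * ((A + 1) * (A + 1)) + A + (4 * (3 * A + A + 2) ^ 2 + 1) + 5) +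
        (A + 1) * (A * (2 * ((A + 1) * (A + 1)) + 3) + (4 * (3 * A + A + 2) ^ 2 + 1) + 3) + A := by
  classical
  set P₀ := optionEquivLeft F β H with hP₀
  have hP₀0 : P₀ ≠ 0 := fun h0 =>
    hH ((optionEquivLeft F β).injective (by rw [← hP₀, h0, map_zero]))
  have hroot' : P₀.IsRoot φ := by
    rw [Polynomial.IsRoot.def, hP₀, eval_oel_eq_aeval]
    exact hroot
  set e₀ := P₀.rootMultiplicity φ with he₀
  have he0 : 0 < e₀ := (Polynomial.rootMultiplicity_pos hP₀0).2 hroot'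
  set Q₀ := P₀ /ₘ (Polynomial.X - Polynomial.C φ) ^ e₀ with hQ₀
  have hfac₀ : P₀ = (Polynomial.X - Polynomial.C φ) ^ e₀ * Q₀ :=
    (Polynomial.pow_mul_divByMonic_rootMultiplicity_eq P₀ φ).symm
  have hq₀ : Q₀.eval φ ≠ 0 :=
    Polynomial.eval_divByMonic_pow_rootMultiplicity_ne_zero φ hP₀0
  obtain ⟨a, ha⟩ : ∃ a : β → F, eval a (Q₀.eval φ) ≠ 0 := by
    by_contra hcon
    push Not at hcon
    exact hq₀ (MvPolynomial.funext fun x => by rw [hcon x, map_zero])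
  set τ : β → MvPolynomial β F := fun b => X b + C (a b) with hτ
  set H₁ : MvPolynomial (Option β) F :=
    aeval (fun o : Option β => o.elim (X none) fun b => X (some b) + C (a b)) H with hH₁
  set φ₁ : MvPolynomial β F := aeval τ φ with hφ₁
  set Q₁ : Polynomial (MvPolynomial β F) := Q₀.map ((aeval τ : MvPolynomial β F →ₐ[F]
    MvPolynomial β F) : MvPolynomial β F →+* MvPolynomial β F) with hQ₁
  obtain ⟨e, he⟩ : ∃ e, e₀ = e + 1 := ⟨e₀ - 1, by omega⟩
  have hfac₁ :
      optionEquivLeft F β H₁ = (Polynomial.X - Polynomial.C φ₁) ^ (e + 1) * Q₁ := by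
    rw [hH₁, oel_translate, ← hP₀, hfac₀, Polynomial.map_mul, Polynomial.map_pow,
      Polynomial.map_sub, Polynomial.map_X, Polynomial.map_C, ← hQ₁, he]
    rfl
  have hq₁ : coeff 0 (Q₁.eval φ₁) ≠ 0 := by
    have h1 : Q₁.eval φ₁ = aeval τ (Q₀.eval φ) := by
      rw [hQ₁, hφ₁, Polynomial.eval_map, ← AlgHom.coe_toRingHom, Polynomial.eval₂_hom]
    rw [h1, ← constantCoeff_eq, constantCoeff_translate]
    exact ha
  have hd₁ : φ₁.totalDegree ≤ A := by
    refine le_trans (totalDegree_aeval_linear (fun b => ?_) φ) hd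
    refine (totalDegree_add _ _).trans (max_le (totalDegree_X _).le ?_)
    rw [totalDegree_C]; exact zero_le_one
  have hβA : Fintype.card β ≤ A := le_trans (Nat.le_add_left _ _) hl
  have hH₁A : complexity H₁ ≤ A := by
    refine ((complexity_aeval_le H _).trans ?_).trans hl
    rw [Fintype.sum_option]
    simp only [Option.elim_none, Option.elim_some]
    rw [complexity_X_holds none, zero_add]
    exact Nat.add_le_add_left (sum_cx_X_add_C some a) _
  have hμ : (complexity H₁ + 1) * (A + 1) ≤ (A + 1) * (A + 1) :=
    Nat.mul_le_mul_right _ (by omega)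
  have hΞ : 4 * (3 * complexity H₁ + Fintype.card β + 2) ^ 2 + 1 ≤
      4 * (3 * A + A + 2) ^ 2 + 1 := by gcongr
  have hcore := presBorderComplexity_le_of_factorization H₁ φ₁ Q₁ hfac₁ hq₁ hd₁ hμ hΞ
  calc presBorderComplexity φ
      = presBorderComplexity (aeval (fun b : β => X b + C (-a b)) φ₁) :=
        congrArg presBorderComplexity (translate_back a φ).symm
    _ ≤ presBorderComplexity φ₁ + ∑ b, complexity (X b + C (-a b) : MvPolynomial β F) :=
        presBorderComplexity_aeval_le _ _
    _ ≤ _ + Fintype.card β := add_le_add hcore (sum_cx_X_add_C id fun b => -a b)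
    _ ≤ _ := by gcongr

/-- Arithmetic for the coarse form: `P(A) + R(A) = 32 · (A + 2)^6`, `R ∈ ℕ[A]`. [folklore] -/
private theorem coarse_bound (A : ℕ) :
    2 * (3 * ((A + 1) * (A * (A + 6) + 2 * A + 2)) + 2) ^ 2 +
        5 * (A + 4 * ((A + 1) * (A + 1)) + A + (4 * (3 * A + A + 2) ^ 2 + 1) + 5) +
        (A + 1) * (A * (2 * ((A + 1) * (A + 1)) + 3) + (4 * (3 * A + A + 2) ^ 2 + 1) + 3) + A ≤
      32 * (A + 2) ^ 6 :=
  Nat.le.intro (k := 1770 + 4724 * A + 4539 * A ^ 2 + 1714 * A ^ 3 + 100 * A ^ 4 + 60 * A ^ 5 +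
    14 * A ^ 6) (by ring)

/-- **Roots are presentable (Bürgisser 2004 Thm 1.3 / BDS 2024 Lemma 4.4 in root form, in
the presentable model):** `L_ε(φ) ≤ 32 · (deg φ + L(H) + #β + 2)^6` whenever `φ ∈ F[x_β]`
is a root of a nonzero `H(x, y)` of circuit complexity `L(H)`, characteristic zero — polynomial in
`deg φ` and `L(H)`, INDEPENDENT of `deg H` and of the multiplicity; `L_ε` is BDS's
`presBorderComplexity` (`ε` an input, constants in `F`), one currency above the tree's
`borderComplexity_le_pow_of_isRoot` (constants in `F((ε))`).
[cite: Burgisser2004Factors, Thm. 1.3, Cor. 1.4; BhargavDwivediSaxena2024, Lemma 4.4] -/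
theorem presBorderComplexity_le_pow_of_isRoot (φ : MvPolynomial β F)
    {H : MvPolynomial (Option β) F} (hH : H ≠ 0)
    (hroot : bind₁ (fun o : Option β => o.elim φ X) H = 0) :
    presBorderComplexity φ ≤ 32 * (φ.totalDegree + complexity H + Fintype.card β + 2) ^ 6 :=
  (presBorderComplexity_le_of_isRoot_aux φ hH hroot
    (A := φ.totalDegree + complexity H + Fintype.card β) (by omega) (by omega)).trans
    (coarse_bound _)

end Main

section Families

variable {F : Type u} [Field F] [CharZero F] {ς : ℕ → Type v} [∀ n, Fintype (ς n)]

/-- **Family form: p-families that are roots of p-size circuits of ARBITRARY degree lie in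
`\overline{VP}_ε`** (`IsPresVPBarFamily`): `H_n ≠ 0` of p-bounded circuit complexity,
`H_n(x, φ_n(x)) = 0`, `φ_n` a p-family ⟹ `L_ε(φ_n)` p-bounded (characteristic zero).
[cite: Burgisser2004Factors, Thm. 1.3; BhargavDwivediSaxena2024, Lemma 4.4, Def. 4.3] -/
theorem isPresVPBarFamily_of_isRoot (φ : ∀ n, MvPolynomial (ς n) F)
    (H : ∀ n, MvPolynomial (Option (ς n)) F)
    (hH : ∀ n, H n ≠ 0 ∧ bind₁ (fun o : Option (ς n) => o.elim (φ n) X) (H n) = 0)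
    (hHc : IsPComputable H) (hφ : IsPFamily φ) : IsPresVPBarFamily φ := by
  have hHc' : IsPBounded fun n => complexity (H n) := hHc
  have hB : IsPBounded fun n =>
      32 * ((φ n).totalDegree + complexity (H n) + Fintype.card (ς n) + 2) ^ 6 :=
    IsPBounded.mul_holds (IsPBounded.const 32) (IsPBounded.pow_holds (IsPBounded.add_holds
      (IsPBounded.add_holds (IsPBounded.add_holds hφ.2 hHc') hφ.1) (IsPBounded.const 2)) 6)
  exact hB.mono fun n => presBorderComplexity_le_pow_of_isRoot (φ n) (hH n).1 (hH n).2

/-- **The edge `U_ε → U_root` of road E1**: item 23449 `ClosureDefinablePres`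
(`\overline{VP}_ε ⊆ VNP` over `ℂ` on p-families) implies item 23450 `RootsDefinable` (p-degree
roots of p-size circuits of arbitrary degree are p-definable); the unconditional half is
`isPresVPBarFamily_of_isRoot`. [cite: BhargavDwivediSaxena2024, Lemma 4.4, Cor. 1.5] -/
theorem rootsDefinable_of_closureDefinablePres :
    Theses.VPBoundarySquare.ClosureDefinablePres → Theses.VPBoundarySquare.RootsDefinable :=
  by intro hU v φ H hH hHc hφ; exact hU v φ hφ (isPresVPBarFamily_of_isRoot φ H hH hHc hφ)

end Families

end Summit.ValiantsHypothesis.ValiantsHypothesis.Theorems.VPBoundarySquareRootsDefinable
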